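import Mathlib

/-!
# The variational characterisation of the inverse quadratic form `Re⟨v, A⁻¹ v⟩` of a positive
# definite matrix: trial vectors FLOOR it, only an operator lower bound (a gap) CEILS it

For a positive definite complex matrix `A ≻ 0` and a vector `v`, completion of the square gives
`Re⟨x − A⁻¹v, A (x − A⁻¹v)⟩ ≥ 0`, i.e.

  `2 Re⟨v, x⟩ − Re⟨x, A x⟩ ≤ Re⟨v, A⁻¹ v⟩`   for every trial vector `x`,

with equality at `x = A⁻¹ v`; hence `Re⟨v, A⁻¹ v⟩ = sup_x (2 Re⟨v, x⟩ − Re⟨x, A x⟩)` (Horn–Johnson, *Matrix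
Analysis*, §7.7: the Schur-complement / completion-of-squares characterisation of `v* A⁻¹ v`). Dually, an operator
LOWER bound `A ⪰ a·1` with `a > 0` (a "gap") gives the CEILING `Re⟨v, A⁻¹ v⟩ ≤ Re⟨v, v⟩/a`.

Use (cell hubbard-cq, hubbard-cq-lens-dual-2 DUALITY-MEMO v2 §A, census line (29) «K-producer»): a static
susceptibility of a gapped finite system is `2 Re⟨v, A⁻¹ v⟩` with `A = (H − E₀)|_{Qℋ} ≻ 0`, `v = Q O ψ₀`; so every
finite certificate made of trial vectors can only FLOOR a susceptibility, and a CEILING needs an operator lower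
bound on `A` in the channel of `v` (a spectral gap), `GapCeilsInverse`. This file is the model-free linear algebra;
the three statements are exactly the `Prop`s `TrialFloorsInverse`, `TrialFloorAttained`, `GapCeilsInverse` typed by
dual-2 (HOME/lean/DualLensSketch-dual2-g2.lean), proved.

Contents: `two_mul_re_sub_re_le_re_inv` (trial floor), `two_mul_re_sub_re_eq_re_inv` (attained at `A⁻¹v`),
`isGreatest_re_inv` / `re_inv_eq_ciSup` (the supremum form), `posDef_of_sub_smul_one_posSemidef` (a gap makes
`A` positive definite), `re_inv_le_div_of_gap` (the gap ceiling). No definition; no named fact; no `sorry`.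
-/

namespace Literature.LinearAlgebra

open Matrix
open scoped ComplexOrder

variable {n : Type*} [Fintype n] [DecidableEq n] {A : Matrix n n ℂ}

omit [DecidableEq n] in
/-- `Re⟨x, y⟩ = Re⟨y, x⟩` for complex vectors. [folklore] -/
private theorem re_star_dotProduct_comm (x y : n → ℂ) : (star x ⬝ᵥ y).re = (star y ⬝ᵥ x).re := by
  rw [Matrix.star_dotProduct, Complex.star_def, Complex.conj_re]

omit [DecidableEq n] in
/-- Hermitian symmetry of real parts: `Re⟨x, A y⟩ = Re⟨y, A x⟩` for Hermitian `A`. [folklore] -/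
private theorem re_star_dotProduct_mulVec_comm (hA : A.IsHermitian) (x y : n → ℂ) :
    (star x ⬝ᵥ A *ᵥ y).re = (star y ⬝ᵥ A *ᵥ x).re := by
  rw [Matrix.star_dotProduct, Matrix.star_mulVec, hA.eq, ← Matrix.dotProduct_mulVec, Complex.star_def,
    Complex.conj_re]

/-- For a positive definite `A`, `A (A⁻¹ v) = v`. [folklore] -/
private theorem mulVec_inv_mulVec (hA : A.PosDef) (v : n → ℂ) : A *ᵥ (A⁻¹ *ᵥ v) = v := by
  rw [Matrix.mulVec_mulVec, Matrix.mul_nonsing_inv A ((Matrix.isUnit_iff_isUnit_det A).mp hA.isUnit),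
    Matrix.one_mulVec]

/-- **Trial vectors floor the inverse quadratic form** (completion of the square, `TrialFloorsInverse`): for a
positive definite complex matrix `A` and all vectors `v, x`, `2 Re⟨v, x⟩ − Re⟨x, A x⟩ ≤ Re⟨v, A⁻¹ v⟩`.
[cite: HornJohnson2013, §7.7] -/
theorem two_mul_re_sub_re_le_re_inv (hA : A.PosDef) (v x : n → ℂ) :
    2 * (star v ⬝ᵥ x).re - (star x ⬝ᵥ A *ᵥ x).re ≤ (star v ⬝ᵥ A⁻¹ *ᵥ v).re := by
  set y := A⁻¹ *ᵥ v with hy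
  have hAy : A *ᵥ y = v := mulVec_inv_mulVec hA v
  have h0 : 0 ≤ (star (x - y) ⬝ᵥ A *ᵥ (x - y)).re :=
    (Complex.nonneg_iff.mp (hA.posSemidef.dotProduct_mulVec_nonneg (x - y))).1
  have hexp : star (x - y) ⬝ᵥ A *ᵥ (x - y) =
      star x ⬝ᵥ A *ᵥ x - star x ⬝ᵥ A *ᵥ y - star y ⬝ᵥ A *ᵥ x + star y ⬝ᵥ A *ᵥ y := by
    rw [star_sub, Matrix.mulVec_sub, sub_dotProduct, dotProduct_sub, dotProduct_sub]
    ring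
  rw [hexp, hAy] at h0
  simp only [Complex.sub_re, Complex.add_re] at h0
  have h1 : (star y ⬝ᵥ A *ᵥ x).re = (star x ⬝ᵥ v).re := by
    rw [re_star_dotProduct_mulVec_comm hA.isHermitian, hAy]
  have h2 : (star x ⬝ᵥ v).re = (star v ⬝ᵥ x).re := re_star_dotProduct_comm x v
  have h3 : (star y ⬝ᵥ v).re = (star v ⬝ᵥ y).re := re_star_dotProduct_comm y v
  linarith

/-- **The trial floor is attained at `x = A⁻¹ v`** (`TrialFloorAttained`): `2 Re⟨v, A⁻¹v⟩ − Re⟨A⁻¹v, A A⁻¹v⟩ =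
Re⟨v, A⁻¹ v⟩` — so the floor family is complete and no certificate made of trial vectors can CEIL `Re⟨v, A⁻¹ v⟩`
below its value. [cite: HornJohnson2013, §7.7] -/
theorem two_mul_re_sub_re_eq_re_inv (hA : A.PosDef) (v : n → ℂ) :
    2 * (star v ⬝ᵥ (A⁻¹ *ᵥ v)).re - (star (A⁻¹ *ᵥ v) ⬝ᵥ A *ᵥ (A⁻¹ *ᵥ v)).re = (star v ⬝ᵥ A⁻¹ *ᵥ v).re := by
  rw [mulVec_inv_mulVec hA v, re_star_dotProduct_comm (A⁻¹ *ᵥ v) v]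
  ring

/-- **The variational identity as a greatest element**: `Re⟨v, A⁻¹ v⟩` is the greatest value of
`x ↦ 2 Re⟨v, x⟩ − Re⟨x, A x⟩`. [cite: HornJohnson2013, §7.7] -/
theorem isGreatest_re_inv (hA : A.PosDef) (v : n → ℂ) :
    IsGreatest (Set.range fun x : n → ℂ => 2 * (star v ⬝ᵥ x).re - (star x ⬝ᵥ A *ᵥ x).re)
      ((star v ⬝ᵥ A⁻¹ *ᵥ v).re) := by
  refine ⟨⟨A⁻¹ *ᵥ v, two_mul_re_sub_re_eq_re_inv hA v⟩, ?_⟩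
  rintro _ ⟨x, rfl⟩
  exact two_mul_re_sub_re_le_re_inv hA v x

/-- **The variational identity as a supremum**: `Re⟨v, A⁻¹ v⟩ = ⨆ₓ (2 Re⟨v, x⟩ − Re⟨x, A x⟩)`.
[cite: HornJohnson2013, §7.7] -/
theorem re_inv_eq_ciSup (hA : A.PosDef) (v : n → ℂ) :
    (star v ⬝ᵥ A⁻¹ *ᵥ v).re = ⨆ x : n → ℂ, (2 * (star v ⬝ᵥ x).re - (star x ⬝ᵥ A *ᵥ x).re) :=
  ((isGreatest_re_inv hA v).isLUB.ciSup_eq).symm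

/-- **A gap makes the matrix positive definite**: if `A − a·1` is positive semidefinite for some `a > 0` then `A` is
positive definite. [cite: HornJohnson2013, §7.7] -/
theorem posDef_of_sub_smul_one_posSemidef {a : ℝ} (ha : 0 < a)
    (hgap : (A - (a : ℂ) • (1 : Matrix n n ℂ)).PosSemidef) : A.PosDef := by
  have hherm : A.IsHermitian := by
    have h := hgap.1
    rw [Matrix.IsHermitian, Matrix.conjTranspose_sub, Matrix.conjTranspose_smul, Matrix.conjTranspose_one,
      Complex.star_def, Complex.conj_ofReal] at h
    exact sub_left_injective h
  refine Matrix.PosDef.of_dotProduct_mulVec_pos hherm fun x hx => ?_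
  have h0 := hgap.dotProduct_mulVec_nonneg x
  rw [Matrix.sub_mulVec, Matrix.smul_mulVec, Matrix.one_mulVec, dotProduct_sub, dotProduct_smul,
    sub_nonneg] at h0
  have hpos : 0 < star x ⬝ᵥ x := Matrix.dotProduct_star_self_pos_iff.mpr hx
  have hapos : (0 : ℂ) < (a : ℂ) • (star x ⬝ᵥ x) := by
    rw [smul_eq_mul]
    exact mul_pos (by exact_mod_cast ha) hpos
  exact hapos.trans_le h0

/-- **A gap ceils the inverse quadratic form** (`GapCeilsInverse`): if `A − a·1` is positive semidefinite with
`a > 0`, then `Re⟨v, A⁻¹ v⟩ ≤ Re⟨v, v⟩/a` for every `v` (from `0 ≤ ‖v − a A⁻¹v‖²` and `a‖A⁻¹v‖² ≤ Re⟨A⁻¹v, v⟩`).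
[cite: HornJohnson2013, §7.7] -/
theorem re_inv_le_div_of_gap {a : ℝ} (ha : 0 < a) (hgap : (A - (a : ℂ) • (1 : Matrix n n ℂ)).PosSemidef)
    (v : n → ℂ) : (star v ⬝ᵥ A⁻¹ *ᵥ v).re ≤ (star v ⬝ᵥ v).re / a := by
  have hA : A.PosDef := posDef_of_sub_smul_one_posSemidef ha hgap
  set y := A⁻¹ *ᵥ v with hy
  have hAy : A *ᵥ y = v := mulVec_inv_mulVec hA v
  -- the gap at `y`: `a · Re⟨y, y⟩ ≤ Re⟨y, A y⟩ = Re⟨y, v⟩ = Re⟨v, y⟩`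
  have hg := hgap.dotProduct_mulVec_nonneg y
  rw [Matrix.sub_mulVec, Matrix.smul_mulVec, Matrix.one_mulVec, dotProduct_sub, dotProduct_smul, hAy,
    smul_eq_mul] at hg
  have hg' : 0 ≤ (star y ⬝ᵥ v).re - a * (star y ⬝ᵥ y).re := by
    have := (Complex.nonneg_iff.mp hg).1
    rwa [Complex.sub_re, Complex.re_ofReal_mul] at this
  -- the square: `0 ≤ Re⟨v − a y, v − a y⟩ = Re⟨v,v⟩ − 2a Re⟨v, y⟩ + a² Re⟨y, y⟩`
  have hsq : 0 ≤ (star (v - (a : ℂ) • y) ⬝ᵥ (v - (a : ℂ) • y)).re :=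
    (Complex.nonneg_iff.mp (dotProduct_star_self_nonneg _)).1
  have hexp : star (v - (a : ℂ) • y) ⬝ᵥ (v - (a : ℂ) • y) =
      star v ⬝ᵥ v - (a : ℂ) * (star v ⬝ᵥ y) - (a : ℂ) * (star y ⬝ᵥ v) + (a : ℂ) * ((a : ℂ) * (star y ⬝ᵥ y)) := by
    rw [star_sub, star_smul, Complex.star_def, Complex.conj_ofReal, sub_dotProduct, dotProduct_sub,
      dotProduct_sub, smul_dotProduct, smul_dotProduct, dotProduct_smul, dotProduct_smul, smul_eq_mul, smul_eq_mul,
      smul_eq_mul, smul_eq_mul]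
    ring
  rw [hexp] at hsq
  simp only [Complex.sub_re, Complex.add_re, Complex.re_ofReal_mul] at hsq
  have h1 : (star y ⬝ᵥ v).re = (star v ⬝ᵥ y).re := re_star_dotProduct_comm y v
  rw [le_div_iff₀ ha]
  nlinarith [hg', hsq, h1, ha]

end Literature.LinearAlgebra
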